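import Literature.NumberTheory.Kottwitz1992.VirtualAbelianVarieties
import Literature.NumberTheory.DiophantineGeometry.AVIsogenyTateHoldsProofs
import HarnessLib

/-!
# [Kottwitz1992, Lemma 10.4 p. 405; Lemma 10.9 (finiteness clause) p. 407] `π_A` maps to `c`-numbers; `Hom_{𝒱_r}(A₁, A₂)` is
# finitely generated — DISCHARGED: `Kottwitz1992_10_4_frob_isCNumber_holds`, `Kottwitz1992_10_9_hom_finitelyGenerated_holds`

Kernel-lane companion of the statement carpet ★ `Literature/NumberTheory/Kottwitz1992/VirtualAbelianVarieties.lean` (squad TK,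
HCML «GO 500»): the named facts ★ `VirtualAbelianVarieties.Kottwitz1992_10_4_frob_isCNumber` («Let `A` be a `c`-polarizable
virtual abelian variety over `k_r` up to prime-to-`p` isogeny […].  Then the image of `π` under any `ℚ`-algebra homomorphism
`ℚ[π] → ℚ̄` is a `c`-number») and ★ `VirtualAbelianVarieties.Kottwitz1992_10_9_hom_finitelyGenerated` (Lemma 10.9's clause
«for any two objects `A₁, A₂` the `ℚ`-vector space `Hom(A₁, A₂)` is finite dimensional», typed as the finite generation of the
group of honest `𝒱_r`-homomorphisms `Ā₁ → Ā₂`) are PROVED here.  THEOREMS ONLY (no definition, no named fact, no `sorry`,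
no instance, no notation); cell hodgecm-mathlib, seat B-typ02 (g32); net debt −2.

R. E. Kottwitz, *Points on some Shimura varieties over finite fields*, J. Amer. Math. Soc. 5 (1992) 373–444, §10: Lemma
10.4 and the definition of `c`-numbers p. 405 (held `paper:doi-10-2307-2152772`, p0033 L22–L36: «We say that an algebraic
number `a ∈ ℚ̄` is a `c`-number if the image of `a` under any embedding `ℚ̄ → ℚ̄_p` lies in the valuation ring of `ℚ̄_p` and the
image of `a` under any embedding `ℚ̄ → ℂ` has absolute value `c^{1/2}`. […] It follows from Lemma 10.3 that the image of
`π` under any homomorphism `ℚ[π] → ℂ` has absolute value `c^{1/2}`.»), Lemma 10.9 p. 407.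

THE PROOFS.  Lemma 10.4: the absolute-value half is the print («follows from Lemma 10.3», here the Frobenius
characterisation `InVc` of `𝒱_{r,c}`: every `ψ ∘ φ : ℚ[π] → K → ℂ` is a `ℚ`-algebra homomorphism to `ℂ`); the `p`-integrality
half (printed as «Since `R` is a faithful representation of `End(A) ⊗ ℚ_p` … `π` … preserves a lattice», p. 405 L34–L39) is
obtained here directly from `π = m⁻¹ · (Φ_r ≫ u)` with `p ∤ m` (the carrier's presentation of the prime-to-`p` quasi-isogeny
`u`): `Φ_r ≫ u ∈ End(Ā)` is integral over `ℤ` because `End(Ā)` is a finitely generated `ℤ`-module (Mumford §19 Thm. 3, the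
tree's ★ `AbelianVariety.module_finite_hom_holds`; Cayley–Hamilton, Mathlib `IsIntegral.of_finite`), and if `Q ∈ ℤ[T]` is
monic with `Q(Φ_r ≫ u) = 0` then `P(T) = Q(mT) ∈ ℤ[T]` kills `π`, with leading coefficient `m^{deg Q}` prime to `p` — which is
the typed rendering of «`p`-adically integral» (`IsCNumber`: a root of an integer polynomial with leading coefficient prime to
`p`).  Lemma 10.9 (finiteness clause): the `𝒱_r`-homomorphisms `{f | m₂ (Φ ≫ u₁) f = m₁ f (Φ ≫ u₂)}` form a `ℤ`-submodule of
`Hom(Ā₁, Ā₂)`, finitely generated by Mumford §19 Thm. 3 (★ `module_finite_hom_holds`) since `ℤ` is noetherian — as the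
carpet itself notes («recorded for completeness only: it already follows from the finite generation of `Hom(Ā₁, Ā₂)`»).
HONEST LABEL: HC_CM is proved only modulo the 7 printed citations (2 remaining: hLiu418, h413) until rung 0 closes; this file adds
no citation debt (0 facts, 0 sorry) and discharges 2 named facts of ★ `VirtualAbelianVarieties`; it is off the HC_CM cone.

## References
* [Kottwitz1992] R. E. Kottwitz, Points on some Shimura varieties over finite fields, J. Amer. Math. Soc. 5 (1992) 373–444,
  §10 Lemma 10.4 (p. 405), Lemma 10.9 (p. 407).
* [MumfordAV1970] D. Mumford, Abelian Varieties (1970), §19 Thm. 3 (through the tree's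
  `NumberTheory/DiophantineGeometry/AVIsogenyTateHoldsProofs`).
-/

open Polynomial CategoryTheory

namespace Literature.NumberTheory.Kottwitz1992.VirtualAbelianVarieties

open Literature.AlgebraicGeometry.Motives Literature.AlgebraicGeometry.Motives.AbelianVariety VirtualAbelianVariety

/-! ## Lemma 10.9, the finiteness clause -/

/-- **KOTTWITZ 1992, LEMMA 10.9 (finiteness clause), PROVED**: ★ `Kottwitz1992_10_9_hom_finitelyGenerated` holds — the
group of `𝒱_r`-homomorphisms `Ā₁ → Ā₂` (`f π₁ = π₂ f`, denominators cleared) is finitely generated: it is a subgroup of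
`Hom(Ā₁, Ā₂)`, which is a finitely generated abelian group by Mumford §19 Thm. 3 (the tree's ★
`AbelianVariety.module_finite_hom_holds`), and `ℤ` is noetherian. [cite: Kottwitz1992, §10 Lemma 10.9 (p. 407)] -/
theorem Kottwitz1992_10_9_hom_finitelyGenerated_holds : Kottwitz1992_10_9_hom_finitelyGenerated := by
  intro k _ _ p _ _ _ _ r _ c _ _ V W _ _
  classical
  haveI : Module.Finite ℤ (V.A ⟶ W.A) := module_finite_hom_holds V.A W.A
  -- the `𝒱_r`-homomorphisms form a `ℤ`-submodule of `Hom(Ā_V, Ā_W)`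
  have hadd : ∀ g g' : V.A ⟶ W.A, IsHom W g → IsHom W g' → IsHom W (g + g') := fun g g' hg hg' => by
    unfold IsHom at hg hg' ⊢
    rw [Preadditive.comp_add, Preadditive.add_comp, smul_add, smul_add, hg, hg']
  have hzero : IsHom W (0 : V.A ⟶ W.A) := by
    unfold IsHom
    rw [Limits.comp_zero, Limits.zero_comp, smul_zero, smul_zero]
  have hsmul : ∀ (n : ℤ) (g : V.A ⟶ W.A), IsHom W g → IsHom W (n • g) := fun n g hg => by
    unfold IsHom at hg ⊢
    rw [Preadditive.comp_zsmul, Preadditive.zsmul_comp, smul_comm W.m n, smul_comm V.m n, hg]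
  let H : Submodule ℤ (V.A ⟶ W.A) :=
    { carrier := {g | IsHom W g}
      add_mem' := fun {g g'} hg hg' => hadd g g' hg hg'
      zero_mem' := hzero
      smul_mem' := fun n g hg => hsmul n g hg }
  obtain ⟨s, hs⟩ : H.FG := IsNoetherian.noetherian H
  refine ⟨s.card, fun i => ((s.equivFin.symm i : s) : V.A ⟶ W.A), fun i => ?_, fun g hg => ?_⟩
  · have hmem : ((s.equivFin.symm i : s) : V.A ⟶ W.A) ∈ H := by
      rw [← hs]
      exact Submodule.subset_span (s.equivFin.symm i).2
    exact hmem
  · have hrange : Set.range (fun i => ((s.equivFin.symm i : s) : V.A ⟶ W.A)) = (s : Set (V.A ⟶ W.A)) := by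
      ext g
      constructor
      · rintro ⟨i, rfl⟩
        exact (s.equivFin.symm i).2
      · intro hg
        exact ⟨s.equivFin ⟨g, hg⟩, by simp⟩
    rw [hrange, ← Submodule.span_int_eq_addSubgroupClosure, hs]
    exact hg

/-! ## Lemma 10.4 -/

/-- **KOTTWITZ 1992, LEMMA 10.4, PROVED**: ★ `Kottwitz1992_10_4_frob_isCNumber` holds — for `A ∈ 𝒱_{r,c}` the image `a`
of `π = π_A` under any `ℚ`-algebra homomorphism `ℚ[π] → K` into a number field is a `c`-number: (i) `a` is `p`-integral —
`π = m⁻¹ (Φ_r ≫ u)` with `p ∤ m` and `Φ_r ≫ u ∈ End(Ā)` integral over `ℤ` (`End(Ā)` is a finitely generated `ℤ`-module,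
Mumford §19 Thm. 3 = ★ `AbelianVariety.module_finite_hom_holds`), so if `Q ∈ ℤ[T]` is monic with `Q(Φ_r ≫ u) = 0` then
`P(T) = Q(mT) ∈ ℤ[T]` has leading coefficient `m^{deg Q}`, prime to `p`, and `P(π) = 0`; (ii) `|ψ(a)|² = c` for every
`ψ : K → ℂ`, because `ψ ∘ φ` is a `ℚ`-algebra homomorphism `ℚ[π] → ℂ` (the Frobenius characterisation `InVc` = Lemma 10.3
(3)).  («It follows from Lemma 10.3 that the image of `π` under any homomorphism `ℚ[π] → ℂ` has absolute value `c^{1/2}`»,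
p. 405.) [cite: Kottwitz1992, §10 Lemma 10.4 (p. 405)] -/
theorem Kottwitz1992_10_4_frob_isCNumber_holds : Kottwitz1992_10_4_frob_isCNumber := by
  intro k _ _ p _ _ _ _ r _ c _ _ V hV K _ _ φ
  classical
  refine ⟨?_, fun ψ => ?_⟩
  · -- (i) `p`-integrality
    -- `End(Ā)` is a finitely generated `ℤ`-module (Mumford §19 Thm. 3); the instance is pinned to the `ℤ`-algebra
    -- structure of `End(Ā)` that `IsIntegral` uses
    haveI : @Module.Finite ℤ (End V.A) _ _ Algebra.toModule := module_finite_hom_holds V.A V.A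
    have hm0 : V.m ≠ 0 := fun h => V.not_dvd (h ▸ dvd_zero p)
    -- `F = Φ_r ≫ u ∈ End(Ā)` is integral over `ℤ` (Cayley–Hamilton), hence so is its image in `End⁰(Ā)`
    obtain ⟨Q, hQm, hQ0⟩ : IsIntegral ℤ V.frobNum := IsIntegral.of_finite ℤ V.frobNum
    have hQ : aeval (endAlgebra.of V.A V.frobNum) Q = 0 := by
      have h := Polynomial.hom_eval₂ Q (algebraMap ℤ (End V.A)) (endAlgebra.of V.A) V.frobNum
      rw [hQ0, map_zero, Subsingleton.elim ((endAlgebra.of V.A).comp (algebraMap ℤ (End V.A)))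
        (algebraMap ℤ V.A.endAlgebra)] at h
      rw [aeval_def]
      exact h.symm
    -- `m π = F`
    have hπ : algebraMap ℤ V.A.endAlgebra V.m * V.frob = endAlgebra.of V.A V.frobNum := by
      rw [VirtualAbelianVariety.frob, ← mul_assoc, map_natCast, ← map_natCast (algebraMap ℚ V.A.endAlgebra),
        ← map_mul, mul_inv_cancel₀ (Nat.cast_ne_zero.mpr hm0 : (V.m : ℚ) ≠ 0), map_one, one_mul]
    -- `P(T) = Q(m T)`
    refine ⟨Q.comp (C (V.m : ℤ) * Polynomial.X), ?_, ?_⟩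
    · rw [leadingCoeff_comp (by rw [natDegree_C_mul_X _ (Int.natCast_ne_zero.mpr hm0)]; exact one_ne_zero),
        leadingCoeff_C_mul_X, hQm.leadingCoeff, one_mul]
      intro hdvd
      exact V.not_dvd (Int.natCast_dvd_natCast.mp ((Nat.prime_iff_prime_int.mp Fact.out).dvd_of_dvd_pow hdvd))
    · -- `P(φ π) = φ (P(π))`, and `P(π) = Q(m π) = Q(F) = 0` in `End⁰(Ā)`
      have h1 : aeval V.frob (Q.comp (C (V.m : ℤ) * Polynomial.X)) = 0 := by
        rw [aeval_comp, map_mul, aeval_C, aeval_X, hπ]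
        exact hQ
      have h2 : aeval V.frobGen (Q.comp (C (V.m : ℤ) * Polynomial.X)) = 0 := by
        apply Subtype.val_injective
        have h := aeval_algHom_apply (V.frobAlg.val.toRingHom.toIntAlgHom) V.frobGen (Q.comp (C (V.m : ℤ) * Polynomial.X))
        simp only [RingHom.toIntAlgHom_apply, AlgHom.toRingHom_eq_coe, AlgHom.coe_toRingHom, Subalgebra.coe_val] at h
        rw [Subalgebra.coe_zero, ← h]
        exact h1
      have h3 := aeval_algHom_apply (φ.toRingHom.toIntAlgHom) V.frobGen (Q.comp (C (V.m : ℤ) * Polynomial.X))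
      rw [h2, map_zero, RingHom.toIntAlgHom_apply] at h3
      exact h3
  · -- (ii) absolute values, from `InVc`
    simpa using hV.2 ((ψ.toRatAlgHom).comp φ)

end Literature.NumberTheory.Kottwitz1992.VirtualAbelianVarieties
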